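import Mathlib
import Summits.Ventures.HodgeRepro.Tier4.Target
import Summits.Ventures.HodgeRepro.Tier4.Line4.AnisotropicLines
import Summits.Ventures.HodgeRepro.Tier4.Line4.SeesawCarry

/-!
# Tier4/Line4/SeesawScalars — the consumer dictionary of C-L4-CARRY: the seesaw scalars READ OFF two lines of `V`

Blind re-derivation cell `pub-hodge-repro`, Tier 4 «prove the step» (README §9–§10), seat t4-L1-p1 g5 (prover, LINE L4
chair; the (b) half of lead S16150 / crit-2 Entry 386, yielded by L2-p1 g4 S16176; census §16 ERRATUM-2: the scalars are
read off the face's lines).  Tree path `lean/Summits/Ventures/HodgeRepro/Tier4/Line4/SeesawScalars.lean`.  Mathlib-level;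
no literature; ONE `def` (`lineScalar`).

WHAT IS PROVED (sorry-free, axioms `[propext, Classical.choice, Quot.sound]`; `c := (IsCMField.complexConj E).toRingEquiv`).
* `conj_hform (hH : IsCHermitian c H) (x y) : c ⟪x, y⟫_H = ⟪y, x⟫_H` (`cstar c H = H`, `c` an involution), hence
  `hform_self_mem_maximalRealSubfield : ⟪x, x⟫_H ∈ E⁺` (Mathlib's `IsCMField.complexConj_eq_self_iff`).
* **`def lineScalar (hH) (x : Fin 3 → E) : ↥(maximalRealSubfield E)`** = `⟪x, x⟫_H` as an element of `E⁺`, with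
  `algebraMap_lineScalar`, `algebraMap_neg_lineScalar`.
* **`seesawDefinite_of_lines`**: CARRY (`seesawDefinite_of_orthogonal_lines`, SeesawCarry p714475) at the dictionary
  `a 0 = lineScalar hH e₁`, `a 2 = -lineScalar hH e₂` with `h₁ / h₂` discharged from `Anisotropic` + `e₁, e₂ ≠ 0`
  (L2-p1's `hform_self_ne_zero_of_anisotropic`, AnisotropicLines p716230): the binders are the face's `H hH hani τ₀ hdef`
  (TargetData L47–L107 shape), the quadratic datum `q` with `hcm`, two non-zero lines and the two dictionary equations —
  the costume keeps only `_hpos` (the signs of the lines at `τ₀`) as the face-data residual.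

Nothing here says anything about the status of the Hodge conjecture for CM abelian varieties, which is NOT proved
(HC_CM is NOT proved by anyone in this repository).
-/

set_option autoImplicit false
noncomputable section
namespace Summit.Ventures.HodgeRepro.Tier4.Line4
open Summit.Ventures.HodgeRepro.Tier4 Summit.Ventures.HodgeRepro.Tier4.Common NumberField Matrix

section Scalars
variable {E : Type} [Field E] [NumberField E] [IsCMField E]

/-- **`c ⟪x, y⟫_H = ⟪y, x⟫_H`** for a `c`-hermitian `H` (`cstar c H = H`, `c ∘ c = id`), `c = complexConj E`. -/
theorem conj_hform {H : Matrix (Fin 3) (Fin 3) E} (hH : IsCHermitian (IsCMField.complexConj E).toRingEquiv H)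
    (x y : Fin 3 → E) :
    IsCMField.complexConj E (hform (IsCMField.complexConj E).toRingEquiv H x y) =
      hform (IsCMField.complexConj E).toRingEquiv H y x := by
  have hcc : ∀ z : E, IsCMField.complexConj E (IsCMField.complexConj E z) = z := fun z =>
    IsCMField.complexConj_apply_apply E z
  have hHij : ∀ i j, IsCMField.complexConj E (H i j) = H j i := by
    intro i j
    have := congrFun (congrFun hH j) i
    simpa [cstar, Matrix.transpose_apply, Matrix.map_apply] using this
  unfold hform
  simp only [dotProduct, Matrix.mulVec, map_sum, map_mul, AlgEquiv.coe_ringEquiv, hcc, hHij, Finset.mul_sum]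
  rw [Finset.sum_comm]
  refine Finset.sum_congr rfl fun j _ => Finset.sum_congr rfl fun i _ => ?_
  ring

/-- `⟪x, x⟫_H` is fixed by the complex conjugation, hence lies in the maximal real subfield `E⁺`. -/
theorem hform_self_mem_maximalRealSubfield {H : Matrix (Fin 3) (Fin 3) E}
    (hH : IsCHermitian (IsCMField.complexConj E).toRingEquiv H) (x : Fin 3 → E) :
    hform (IsCMField.complexConj E).toRingEquiv H x x ∈ maximalRealSubfield E :=
  (IsCMField.complexConj_eq_self_iff E _).1 (conj_hform hH x x)

/-- **The seesaw scalar of a line**: `⟪x, x⟫_H` as an element of `E⁺` (the dictionary `a 0 := lineScalar hH e₁`,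
`a 2 := −lineScalar hH e₂` of census §16 ERRATUM-2). -/
def lineScalar {H : Matrix (Fin 3) (Fin 3) E} (hH : IsCHermitian (IsCMField.complexConj E).toRingEquiv H)
    (x : Fin 3 → E) : ↥(maximalRealSubfield E) :=
  ⟨hform (IsCMField.complexConj E).toRingEquiv H x x, hform_self_mem_maximalRealSubfield hH x⟩

/-- `lineScalar` read back in `E`. -/
theorem algebraMap_lineScalar {H : Matrix (Fin 3) (Fin 3) E}
    (hH : IsCHermitian (IsCMField.complexConj E).toRingEquiv H) (x : Fin 3 → E) :
    algebraMap ↥(maximalRealSubfield E) E (lineScalar hH x) = hform (IsCMField.complexConj E).toRingEquiv H x x :=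
  rfl

/-- `−lineScalar` read back in `E`. -/
theorem algebraMap_neg_lineScalar {H : Matrix (Fin 3) (Fin 3) E}
    (hH : IsCHermitian (IsCMField.complexConj E).toRingEquiv H) (x : Fin 3 → E) :
    algebraMap ↥(maximalRealSubfield E) E (-lineScalar hH x) =
      -hform (IsCMField.complexConj E).toRingEquiv H x x := by
  rw [map_neg, algebraMap_lineScalar]

/-- **CARRY at the dictionary**: for two non-zero `H`-orthogonal lines `e₁, e₂` of the anisotropic `V` and the
scalars `a 0 = ⟪e₁,e₁⟫_H`, `a 2 = −⟪e₂,e₂⟫_H` (as elements of `E⁺`), the seesaw plane is `SeesawDefinite` at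
`w₀ = mk (τ₀ ∘ ι)` — `h₁ / h₂` of `seesawDefinite_of_orthogonal_lines` discharged from `Anisotropic`
(`hform_self_ne_zero_of_anisotropic`, AnisotropicLines p716230). -/
theorem seesawDefinite_of_lines (H : Matrix (Fin 3) (Fin 3) E)
    (hH : IsCHermitian (IsCMField.complexConj E).toRingEquiv H) (τ₀ : E →+* ℂ)
    (hdef : ∀ τ : E →+* ℂ, τ ≠ τ₀ → τ ≠ conjEmb τ₀ → IsDefinite (H.map τ))
    (hani : Anisotropic (IsCMField.complexConj E).toRingEquiv H)
    (q : QuadData ↥(maximalRealSubfield E)) (hcm : ∀ w, IsCMAt q w) (e₁ e₂ : Fin 3 → E)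
    (h₁ : e₁ ≠ 0) (h₂ : e₂ ≠ 0) (horth : hform (IsCMField.complexConj E).toRingEquiv H e₁ e₂ = 0)
    (a : Fin 4 → ↥(maximalRealSubfield E)) (ha0 : a 0 = lineScalar hH e₁) (ha2 : a 2 = -lineScalar hH e₂) :
    SeesawDefinite q a (InfinitePlace.mk (τ₀.comp (algebraMap ↥(maximalRealSubfield E) E))) :=
  seesawDefinite_of_orthogonal_lines E H hH τ₀ hdef q hcm e₁ e₂ horth a
    (by rw [ha0, algebraMap_lineScalar]) (by rw [ha2, algebraMap_neg_lineScalar])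
    (hform_self_ne_zero_of_anisotropic _ H hani h₁) (hform_self_ne_zero_of_anisotropic _ H hani h₂)

end Scalars

end Summit.Ventures.HodgeRepro.Tier4.Line4

end
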